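import Summits.MatrixMultiplication.MatrixMultiplication.Theorems.OutsiderSandwichColumnDisjoint
import HarnessLib

/-!
# Span covers by translates of the twist-invariants are column-disjoint certificates

Route `OutsiderSandwich` (decomposition cell `decomp-mm`, lens 4, gen 27), support for the aside
leaf `BlockOneIsMM` (stmt-MatrixMultiplication-27147); cut of record untouched; theorem-only.

The census's SPAN-COVER LEMMA (COSTUME-CENSUS I59 (R) / I74 §0; lens 2's `ssMatMul_cover` is the
level-two instance) turns a cover `M_{2^N} = Σ_{j ∈ ι} G_j · 𝐒_N · H_j` of the matrix space by `|ι|`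
two-sided translates of the twist-invariants `𝐒_N = Sym₂^{⊗N}` (with a linear section
`X = Σ_j G_j · S_j(X) · H_j`, `S_j(X) ∈ 𝐒_N`) into a certificate `⟨|ι|⟩ ⊠ C₁^{⊠N} ≥ ⟨2^N,2^N,2^N⟩`
through the symmetric core.  This file records, in the twist formalism of
`OutsiderSandwichColumnDisjoint`, that such a section IS a column-disjoint sign-untwisted wiring
(copy `j`: `x`-leg `S_j`, block `(j,c)` wired to column `c` with vector legs `G_j, H_j`, `ε = 1`):
`spanCover_wiring`; hence the no-go `four_pow_le_card_mul_three_pow` prices every span cover,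
`4^N ≤ |ι| · 3^N` (`four_pow_le_card_of_spanCover`) — of course also immediate from dimensions
(`|ι| · dim 𝐒_N ≥ dim M_{2^N}`); the point is the docking: the census's finite certificates
`r_P(N) = ⌈(4/3)^N⌉` (`N ≤ 8`, I75, permutation translates) and the asymptotic `θ_P = log₂(4/3)`
(I74, Pauli-code translates) all live INSIDE the class bounded by `four_pow_le_card_mul_three_pow`,
so that bound is attained for `N ≤ 8` and asymptotically tight in rate; `levelTwo_certificate_exists`
(`OutsiderSandwichColumnDisjointLevelTwo`) is the explicit `N = 2` instance in the tree.

## References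

* M. Bläser, *Fast Matrix Multiplication*, Theory of Computing Graduate Surveys 5 (2013), §5.
  [Blaser2013]
* J.-P. Serre, *Linear Representations of Finite Groups*, GTM 42 (1977), §2.6. [Serre1977]
-/

noncomputable section

open scoped BigOperators Matrix

set_option linter.dupNamespace false
set_option autoImplicit false

namespace Summit.MatrixMultiplication.MatrixMultiplication.Theorems.OutsiderSandwichSpanCover

open Summit.MatrixMultiplication.MatrixMultiplication.Theorems.OutsiderSandwichTwistGluing
  Summit.MatrixMultiplication.MatrixMultiplication.Theorems.OutsiderSandwichColumnDisjoint

universe u v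

variable {K : Type u} [Field K] {N : ℕ} {ι : Type v} [Fintype ι]

/-- **A span-cover section is a column-disjoint sign-untwisted wiring.**  Given two-sided
translates `G j · 𝐒_N · H j` and linear maps `S j` into the twist-invariants
(`ptrans c (S j X) = S j X` for all `c`) with `Σ_j G j · S j X · H j = X`, the wiring
`col j c = some c`, `G' j c = G j`, `H' j c = H j` satisfies the hypotheses `ident` and `hSU` of
`OutsiderSandwichColumnDisjoint.four_pow_le_card_mul_three_pow` (with `ε = 1`). -/
theorem spanCover_wiring (S : ι → Matrix (Idx N) (Idx N) K →ₗ[K] Matrix (Idx N) (Idx N) K)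
    (G H : ι → Matrix (Idx N) (Idx N) K)
    (cover : ∀ X : Matrix (Idx N) (Idx N) K, ∑ j, G j * S j X * H j = X)
    (inv : ∀ (j : ι) (c : Idx N) (X : Matrix (Idx N) (Idx N) K), ptrans c (S j X) = S j X) :
    (∀ (d : Idx N) (X : Matrix (Idx N) (Idx N) K),
        ∑ b ∈ Finset.univ.filter
            (fun b : ι × Idx N => (fun (_ : ι) (c : Idx N) => some c) b.1 b.2 = some d),
          (fun j (_ : Idx N) => G j) b.1 b.2 * ptrans b.2 (S b.1 X) *
            (fun j (_ : Idx N) => H j) b.1 b.2 = X) ∧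
    (∀ (i : ι) (c : Idx N), (fun (_ : ι) (c : Idx N) => some c) i c ≠ none →
        ∃ ε : K, ∀ X : Matrix (Idx N) (Idx N) K, ptrans c (S i X) = ε • S i X) := by
  classical
  refine ⟨fun d X => ?_, fun i c _ => ⟨1, fun X => by rw [inv, one_smul]⟩⟩
  rw [Finset.sum_filter, Fintype.sum_prod_type]
  simp only [Option.some.injEq, Finset.sum_ite_eq', Finset.mem_univ, if_true, inv]
  exact cover X

/-- **Span covers cost `(4/3)^N` translates:** if `|ι|` two-sided translates of `𝐒_N = Sym₂^{⊗N}`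
cover `M_{2^N}` with a linear section through the twist-invariants, then `4 ^ N ≤ |ι| · 3 ^ N`
(via `four_pow_le_card_mul_three_pow`; equivalently by dimension count).  The census certificates
I74/I75 show this is attained for `N ≤ 8` and tight in rate (`θ_P = log₂(4/3)`). -/
theorem four_pow_le_card_of_spanCover
    (S : ι → Matrix (Idx N) (Idx N) K →ₗ[K] Matrix (Idx N) (Idx N) K)
    (G H : ι → Matrix (Idx N) (Idx N) K)
    (cover : ∀ X : Matrix (Idx N) (Idx N) K, ∑ j, G j * S j X * H j = X)
    (inv : ∀ (j : ι) (c : Idx N) (X : Matrix (Idx N) (Idx N) K), ptrans c (S j X) = S j X) :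
    4 ^ N ≤ Fintype.card ι * 3 ^ N := by
  obtain ⟨hident, hsu⟩ := spanCover_wiring S G H cover inv
  exact four_pow_le_card_mul_three_pow S (fun _ c => some c) (fun j _ => G j) (fun j _ => H j)
    hident hsu

/-- **No single translate, no span cover with fewer than `(4/3)^N` translates** — numerics of the
first rungs: `|ι| = 1` is impossible for every `N ≥ 1` (`3^N < 4^N`), and the least admissible
counts for `N = 1, …, 8` are `2, 2, 3, 4, 5, 6, 8, 10 = ⌈(4/3)^N⌉` (all realised by permutation
translates: census I75; `N ≤ 2` in the tree). -/
theorem spanCover_numerics :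
    (∀ N : ℕ, 1 ≤ N → 1 * 3 ^ N < 4 ^ N) ∧
      (1 * 3 ^ 1 < 4 ^ 1 ∧ 4 ^ 1 ≤ 2 * 3 ^ 1) ∧ (1 * 3 ^ 2 < 4 ^ 2 ∧ 4 ^ 2 ≤ 2 * 3 ^ 2) ∧
      (2 * 3 ^ 3 < 4 ^ 3 ∧ 4 ^ 3 ≤ 3 * 3 ^ 3) ∧ (3 * 3 ^ 4 < 4 ^ 4 ∧ 4 ^ 4 ≤ 4 * 3 ^ 4) ∧
      (4 * 3 ^ 5 < 4 ^ 5 ∧ 4 ^ 5 ≤ 5 * 3 ^ 5) ∧ (5 * 3 ^ 6 < 4 ^ 6 ∧ 4 ^ 6 ≤ 6 * 3 ^ 6) ∧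
      (7 * 3 ^ 7 < 4 ^ 7 ∧ 4 ^ 7 ≤ 8 * 3 ^ 7) ∧ (9 * 3 ^ 8 < 4 ^ 8 ∧ 4 ^ 8 ≤ 10 * 3 ^ 8) := by
  refine ⟨fun N hN => ?_, by norm_num⟩
  rw [one_mul]
  exact Nat.pow_lt_pow_left (by norm_num) (by omega)

end Summit.MatrixMultiplication.MatrixMultiplication.Theorems.OutsiderSandwichSpanCover
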